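import Literature.NumberTheory.Transcendental.RoyPadicRankThm4Reduction
import Literature.NumberTheory.Transcendental.RoyPadicRankProofs
import Literature.NumberTheory.Transcendental.RoyRankGenericThm2
import HarnessLib

/-!
# Roy 1992, Theorem 4 for `K = ℚ̄_p` REDUCED to Waldschmidt's `p`-adic Theorem 1 (Roy's proof, §§2–4)

Final proof companion of `Literature/NumberTheory/Transcendental/RoyPadicRank.lean` for the named
fact `roy1992_padic_thm4` (Roy's Theorem 4 [Roy1992, §4 p. 34] for `K = ℚ̄_p = PadicAlgCl p`,
`ℚ̄ = padicQbar p`, `𝓛̃ = RoyPadic.logLinearForms p`). In print Theorem 4 is deduced (§4) from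
Theorem 2, itself deduced (§§2–3) from **Theorem 1 = M. Waldschmidt's Theorem 4.1 of
[Waldschmidt1988] for the group `G_a^{d₀} × G_m^{d₁}`**, over `K = ℂ` and over `K = ℂ_p` alike
("we denote by `ω` the element of `L` equal to `2πi` if `K = ℂ`, equal to `0` otherwise", Notations
p. 24). Both deductions are proved in the tree once over general data `(K, F, L, ω)`
(`RoyRank.thm2_of_thm1`, `RoyRank.thm4_of_thm2`); `…RoyPadicRankThm4Reduction` drew the `p`-adic
instance of the second, and this file composes with the first at `ω = 0`:

* `roy1992_padic_thm4_of_waldschmidt` — **`RoyRank.Thm1 (padicQbar p) (logQSpan p) 0 →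
  roy1992_padic_thm4 p`**: Roy's Theorem 4 for `ℚ̄_p` follows from Waldschmidt's Theorem 1 for
  `ℚ̄_p` (the statement schema `RoyRank.Thm1` at the `p`-adic data `K = ℚ̄_p`, `F = ℚ̄`, `L = ` the
  `ℚ`-span of the logarithms of algebraic principal units, `Ω = 0`), by Roy's own proof;
* composing with the sibling companions `RoyPadicRankThm5Proofs` (Theorem 4 ⇒ Theorem 5) and
  `RoyPadicRankProofs` (Theorem 4 ⇒ Corollary 1 ⇒ Corollary 2): the same for `roy1992_padic_thm5`,
  `roy1992_padic_cor1` and the `p`-adic strong six exponentials theorem.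

So the fact `roy1992_padic_thm4` — and with it `roy1992_padic_thm5`, `roy1992_padic_cor1` and the
`p`-adic strong six exponentials theorem — is CLOSED MODULO the `p`-adic case of Waldschmidt's
algebraic-subgroup theorem for linear groups, which the tree does not have; nothing else of
[Roy1992] remains to be formalized for them. On the source of that input: Theorem 4.1 of
[Waldschmidt1988] is printed, and proved there (§6 auxiliary function, §7 Philippon's zero
estimate), for `K = ℂ`; its `ℂ_p` case for the LINEAR group `G_a^{d₀} × G_m^{d₁}` is what Roy
states as Theorem 1 for "`K` the field `ℂ` or `ℂ_p`" [Roy1992, Notations p. 24 and §1 p. 25: "It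
is Theorem 4.1 of [W3] applied to a linear algebraic group"], the form also used `p`-adically by
M. Laurent for Leopoldt's conjecture [Roy1992, Introduction p. 23]; whoever vendors or proves the
hypothesis `RoyRank.Thm1 (padicQbar p) (logQSpan p) 0` should cite accordingly.

## References

* [Roy1992] D. Roy, *Matrices whose coefficients are linear forms in logarithms*, J. Number Theory
  41 (1992) 22–47: Notations (p. 24); §1 Theorems 1–2 (p. 25); §§2–3; §4 Theorem 4 (p. 34),
  Corollaries 1–2 (p. 38); §5 Theorem 5 (p. 39).
* [Waldschmidt1988] M. Waldschmidt, *On the transcendence methods of Gel'fond and Schneider in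
  several variables*, New Advances in Transcendence Theory (1988), §4 Thm 4.1.
-/

noncomputable section

open Module

namespace Literature.NumberTheory.Transcendental

open RoyPadic

variable (p : ℕ) [Fact p.Prime]

/-- **Roy's Theorem 4 for `ℚ̄_p` from M. Waldschmidt's Theorem 1 for `ℚ̄_p`**
(`RoyRank.Thm1 (padicQbar p) (logQSpan p) 0 → roy1992_padic_thm4 p`): Roy's whole proof
(Theorem 1 ⟹ Theorem 2, §§2–3; Theorem 2 ⟹ Theorem 4, §4) at the `p`-adic data `K = ℚ̄_p`,
`F = ℚ̄`, `L = ` the `ℚ`-span of the logarithms of algebraic principal units, `ω = 0` (`Ω = 0`).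
The hypothesis is exactly the `p`-adic case of [Waldschmidt1988, Thm 4.1] for `G_a^{d₀} × G_m^{d₁}`
in Roy's formulation — the one transcendence input below `roy1992_padic_thm4`, not in the tree.
[cite: Roy1992, §1 Theorem 1 (p. 25) and §4 Theorem 4 (p. 34)] [cite: Waldschmidt1988, §4 Theorem 4.1] -/
theorem roy1992_padic_thm4_of_waldschmidt (h : RoyRank.Thm1 (padicQbar p) (logQSpan p) 0) :
    roy1992_padic_thm4 p :=
  roy1992_padic_thm4_of_thm2Generic p (RoyRank.thm2_of_thm1 h)

/-- **Roy's Theorem 5 for `ℚ̄_p` from Waldschmidt's Theorem 1 for `ℚ̄_p`** (via Theorem 4 and the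
sibling companion's `roy1992_padic_thm5_of_thm4`). [cite: Roy1992, §5 Theorem 5 (p. 39)] -/
theorem roy1992_padic_thm5_of_waldschmidt (h : RoyRank.Thm1 (padicQbar p) (logQSpan p) 0) :
    roy1992_padic_thm5 p :=
  roy1992_padic_thm5_of_thm4 p (roy1992_padic_thm4_of_waldschmidt p h)

/-- **Roy's Corollary 1 for `ℚ̄_p` from Waldschmidt's Theorem 1 for `ℚ̄_p`** (via Theorem 4 and the
sibling companion's `roy1992_padic_cor1_of_thm4`). [cite: Roy1992, §4 Corollary 1 (p. 38)] -/
theorem roy1992_padic_cor1_of_waldschmidt (h : RoyRank.Thm1 (padicQbar p) (logQSpan p) 0) :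
    roy1992_padic_cor1 p :=
  roy1992_padic_cor1_of_thm4 p (roy1992_padic_thm4_of_waldschmidt p h)

/-- **The `p`-adic strong six exponentials theorem from Waldschmidt's Theorem 1 for `ℚ̄_p`**: a
`2 × 3` matrix of linear forms in `p`-adic logarithms of algebraic numbers with algebraic
coefficients, with `ℚ̄`-linearly independent rows and columns, has rank `2` (Roy's Corollary 2 for
`K = ℚ̄_p`, via Theorem 4 ⇒ Corollary 1 ⇒ Corollary 2, all proved in the tree).
[cite: Roy1992, §4 Corollary 2 (p. 38)] -/
theorem roy1992_padic_strongSixExponentials_of_waldschmidt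
    (h : RoyRank.Thm1 (padicQbar p) (logQSpan p) 0)
    (M : Matrix (Fin 2) (Fin 3) (PadicAlgCl p)) (hM : ∀ i j, M i j ∈ logLinearForms p)
    (hrows : LinearIndependent (padicQbar p) (fun i => M i))
    (hcols : LinearIndependent (padicQbar p) (fun j => M.transpose j)) : M.rank = 2 :=
  roy1992_padic_strongSixExponentials_of_thm4 p (roy1992_padic_thm4_of_waldschmidt p h) M hM hrows hcols

end Literature.NumberTheory.Transcendental
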